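import Literature.NumberTheory.EllipticCurves.Rank1Residual.Typed.X5DescentSelmerModeS
import HarnessLib

/-!
# X5 (p = 2): the whole core certificate chain over the tree's Selmer groups

Support file for the BSD rank-≤ 1 residual programme, class X5 (`p = 2`), unit `b2b-bsdres-sha-1`
(gen 5). Everything here is proved; named facts enter only as the hypotheses `hGZK`
(Gross–Zagier–Kolyvagin) and, in the item form, `hCT` (bsd.S18, the Cassels–Tate pairing).

On the census CORE (`SHA-CENSUS.md` §3–§5: `r = 0`, `Ш[2] ≅ (ℤ/2)²`, `ord₂ #Ш_an = 4`) the
certificate `Ш(E/ℚ)[2^∞] ≅ (ℤ/4)²`, i.e. the X5 descent datum at level `2`, is assembled from three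
engine verdicts. Files `X5DescentSelmer` / `X5DescentSelmerModeS` typed the LAST step (engine H,
mode A item / mode S) over the tree's `Sel^(4)`, `Sel^(8)`, `Ш`. This file types the two earlier
steps the same way and composes:

* T-2DESC count (engines A = B [= F] print `t` and `dim Sel^(2) = r + t + 2`):
  `X5.card_sha_two_of_card_selmerTwo` — `#Ш[2] = 4` from `rank E(ℚ) = r`, `#E(ℚ)[2] = 2^t`,
  `#Sel^(2)(E/ℚ) = 2^(r+t+2)` (the tree's proved `card_selmerGroup_eq_pow_rank_mul`, Silverman X.4.2,
  via `card_torsionBy_sha_eq_of_card_selmerGroup`);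
* engine F / PARI CT (the Cassels–Tate pairing on `Sel^(2)` is identically zero ⟺ every 2-Selmer
  class lifts to a 4-Selmer class): `X5.two_divisible_of_selmer_lift` — if every `s ∈ Sel^(2)(E/ℚ)`
  is `[2]_* z` for some `z ∈ Sel^(4)(E/ℚ)` then `Ш[2] ⊆ 2Ш` (by `Sel^(2) ↠ Ш[2]` and
  `π₂ ∘ [2]_* = 2·π₄`, both proved in `X5DescentSelmer`); then `#Ш[4] = 16`
  (`X5.card_sha_four_eq_sixteen`);
* engine H: mode S (`X5.bsdp_two_of_selmer_core_modeS`, GZK only) or ONE item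
  (`X5.bsdp_two_of_selmer_core_item`, GZK + bsd.S18).

So each core row of the census is, in the kernel, a statement about finitely many classes of the
tree's own `Sel^(2)`, `Sel^(4)`, `Sel^(8)` of that curve plus `ord₂ #Ш_an = 4`; what the engines
certify numerically is exactly the truth of those finitely many membership statements.

References: Silverman, *AEC* (2009), Thm. X.4.2; Cassels (1998), §1; Cremona (1997), §3.6;
Stamminger (2005), Thm. 6.2.2; Miller (2011), Def. 1.1.
-/

noncomputable section

open scoped Classical

open WeierstrassCurve Literature.NumberTheory.EllipticCurves

namespace Literature.NumberTheory.EllipticCurves.Rank1Residual.Typed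

variable (W : WeierstrassCurve ℚ) [W.IsElliptic] [W.IsGloballyMinimal]

/-- Arithmetic side condition `4 ∣ 2·2` for `[2]_* : Sel^(4) → Sel^(2)` (content-free private
helper). [folklore] -/
private theorem four_dvd : (4 : ℤ) ∣ 2 * 2 := by norm_num

/-- Arithmetic side condition `8 ∣ 4·2` for `[2]_* : Sel^(8) → Sel^(4)` (content-free private
helper). [folklore] -/
private theorem eight_dvd'' : (8 : ℤ) ∣ 4 * 2 := by norm_num

omit [W.IsElliptic] [W.IsGloballyMinimal] in
/-- **Engine F typed: every 2-Selmer class lifts to a 4-Selmer class ⟹ `Ш[2] ⊆ 2Ш`.**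
(`Sel^(2) ↠ Ш[2]`, and `π₂([2]_* z) = 2·π₄(z)`.) This is the reading of the verdict "the
Cassels–Tate pairing on `Sel^(2)(E/ℚ)` is identically zero / all three `Ш`-type 2-coverings lift
to everywhere-locally-soluble 4-coverings". [cite: Cassels1998, §1; SilvermanAEC2009, Thm. X.4.2(a)] -/
theorem X5.two_divisible_of_selmer_lift
    (hF : ∀ s : W.selmerGroup 2, ∃ z : W.selmerGroup 4, W.selmerZSMul 2 four_dvd z = s) :
    ∀ y : W.sha, 2 • y = 0 → ∃ x : W.sha, 2 • x = y := by
  intro y hy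
  obtain ⟨s, rfl⟩ := W.exists_selmerToSha_eq (n := 2) (by norm_num) y (by rw [ofNat_zsmul]; exact hy)
  obtain ⟨z, rfl⟩ := hF s
  exact ⟨W.selmerToSha 4 z, by rw [selmerToSha_selmerZSMul, ofNat_zsmul]⟩

omit [W.IsGloballyMinimal] in
/-- **T-2DESC count typed: `#Ш[2] = 4`** from `rank E(ℚ) = r`, `#E(ℚ)[2] = 2^t` and
`#Sel^(2)(E/ℚ) = 2^(r+t+2)` (Silverman X.4.2: `#Sel^(2) = 2^rank · #E(ℚ)[2] · #Ш[2]`, the tree's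
proved `card_selmerGroup_eq_pow_rank_mul`). [cite: SilvermanAEC2009, Thm. X.4.2(a); Cremona1997, §3.6] -/
theorem X5.card_sha_two_of_card_selmerTwo {r t : ℕ} (hrank : W.mordellWeilRank = r)
    (ht : Nat.card (AddSubgroup.torsionBy W.toAffine.Point 2) = 2 ^ t)
    (hSel : Nat.card (W.selmerGroup 2) = 2 ^ (r + t + 2)) :
    Nat.card (AddSubgroup.torsionBy W.sha 2) = 4 := by
  -- transport the computable `DecidableEq ℚ` of the binder to the classical one (as in
  -- `Typed/X5DescentRoute.lean`)
  have hinst : (instDecidableEqRat : DecidableEq ℚ) = fun a b => Classical.propDecidable (a = b) :=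
    Subsingleton.elim _ _
  rw [hinst] at ht
  have hpos : 0 < 2 ^ r * 2 ^ t := by positivity
  have hcard : Nat.card (AddSubgroup.torsionBy W.sha (2 : ℕ)) = 2 ^ 2 :=
    card_torsionBy_sha_eq_of_card_selmerGroup W 2 (a := 2 ^ r * 2 ^ t) (c := 2 ^ 2)
      (by rw [hrank]; exact_mod_cast congrArg (2 ^ r * ·) ht) hpos
      (by rw [← pow_add, ← pow_add]; exact_mod_cast hSel)
  simpa using hcard

/-- **X5 core, all over the Selmer groups — MODE S** (granted GZK; no Cassels–Tate): analytic rank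
`≤ 1`; `#E(ℚ)[2] = 2^t` and `#Sel^(2)(E/ℚ) = 2^(r_an+t+2)` (so `#Ш[2] = 4`); every 2-Selmer class
lifts to `Sel^(4)` (so `Ш[2] ⊆ 2Ш`, `#Ш[4] = 16`); every `s ∈ Sel^(4)` above a non-trivial element of
`Ш[2]` lies outside `[2]_* Sel^(8)` (so `Ш[8] = Ш[4]`); `ord₂ #Ш_an = 4`. Then `BSD(E, 2)`.
[cite: Stamminger2005, Thm. 6.2.2; SilvermanAEC2009, Thm. X.4.2(a); Cassels1998, §1; Miller2011LMS, Def. 1.1] -/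
theorem X5.bsdp_two_of_selmer_core_modeS (hGZK : rank_eq_analyticRank_of_analyticRank_le_one)
    (hr : W.analyticRank ≤ 1) {t : ℕ}
    (ht : Nat.card (AddSubgroup.torsionBy W.toAffine.Point 2) = 2 ^ t)
    (hSel : Nat.card (W.selmerGroup 2) = 2 ^ (W.analyticRank + t + 2))
    (hF : ∀ s : W.selmerGroup 2, ∃ z : W.selmerGroup 4, W.selmerZSMul 2 four_dvd z = s)
    (hS : ∀ s : W.selmerGroup 4, 2 • W.selmerToSha 4 s ≠ 0 →
      ¬ ∃ z : W.selmerGroup 8, W.selmerZSMul 2 eight_dvd'' z = s)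
    {q : ℚ} (hq : shaAn W = (q : ℂ)) (hv : padicValRat 2 q = 4) : BSDp W 2 :=
  have h2 := X5.card_sha_two_of_card_selmerTwo W (hGZK W hr).1 ht hSel
  have hdiv := X5.two_divisible_of_selmer_lift W hF
  X5.bsdp_two_of_selmer_modeS W hGZK hr hS (X5.card_sha_four_eq_sixteen W h2 hdiv) hq hv

/-- **X5 core, all over the Selmer groups — ONE ITEM** (granted GZK and bsd.S18): as in
`X5.bsdp_two_of_selmer_core_modeS`, but the last step is a single `s ∈ Sel^(4)(E/ℚ)` with
`2·π₄(s) ≠ 0` and `s ∉ [2]_* Sel^(8)(E/ℚ)`. [cite: Stamminger2005, Thm. 6.2.2; SilvermanAEC2009, Thm. X.4.2(a), Thm. X.4.14; Cassels1998, §1; Cassels1962ArithmeticIV, Thm. 1.1] -/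
theorem X5.bsdp_two_of_selmer_core_item (hGZK : rank_eq_analyticRank_of_analyticRank_le_one)
    (hCT : WeierstrassCurve.exists_casselsTate_pairing (K := ℚ)) (hr : W.analyticRank ≤ 1) {t : ℕ}
    (ht : Nat.card (AddSubgroup.torsionBy W.toAffine.Point 2) = 2 ^ t)
    (hSel : Nat.card (W.selmerGroup 2) = 2 ^ (W.analyticRank + t + 2))
    (hF : ∀ s : W.selmerGroup 2, ∃ z : W.selmerGroup 4, W.selmerZSMul 2 four_dvd z = s)
    {s : W.selmerGroup 4} (hξ : 2 • W.selmerToSha 4 s ≠ 0)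
    (hs : ¬ ∃ z : W.selmerGroup 8, W.selmerZSMul 2 eight_dvd'' z = s)
    {q : ℚ} (hq : shaAn W = (q : ℂ)) (hv : padicValRat 2 q = 4) : BSDp W 2 :=
  have h2 := X5.card_sha_two_of_card_selmerTwo W (hGZK W hr).1 ht hSel
  have hdiv := X5.two_divisible_of_selmer_lift W hF
  X5.bsdp_two_of_selmer_item W hGZK hCT hr h2 hdiv hξ hs (X5.card_sha_four_eq_sixteen W h2 hdiv) hq hv

end Literature.NumberTheory.EllipticCurves.Rank1Residual.Typed

end
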